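import Literature.Computability.AlgebraicComplexity.GrenetEquivariant
import Mathlib.LinearAlgebra.Matrix.Adjugate
import Mathlib.Data.Complex.Basic

/-! # Crux `UniqStep` (stmt-ValiantsHypothesis-17834), line `Sketch` (phase 2: the purified source twist) — stub `stub_adjugate`:
# the `(∅, univ)` cofactor of the purified source twist is `(−1)^k · per_n`

WHAT. Let `n = k + 3`, `R := MvPolynomial (Fin n × Fin n) ℂ` and index rows and columns by
`Finset (Fin n)` (the vertices of Grenet's hypercube). The purified source twist of Grenet's matrix is
`K_full := P · F · EQ` with `F := 1 − Grenet.adj ℂ n` and two products `P`, `EQ` of elementary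
matrices, of which this file only uses four abstract properties (the hypotheses of `stub_adjugate`):
the ROW ACTION of `P` (it only modifies the rows `∅`, `{0}`, `{1}` and the other singletons, by adding
rows of sets of cardinality `≤ 2`), `det P = −1`, the COLUMN ACTION of `EQ` (it only modifies the
columns `{1,2}`, `{1}` and the other singletons, using columns of nonempty sets), `det EQ = (−1)^(k+3)`.
We prove `adj(K_full)_{∅,univ} = (−1)^k · per_n`:
1. the adjugate is anti-multiplicative (`Matrix.adjugate_mul_distrib`), so
   `adj(P F EQ) = adj EQ · adj F · adj P`;
2. the row `∅` of `EQ` is the row `∅` of `1` (column action at `M = 1`), hence the row `∅` of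
   `adj EQ = (EQ · adj EQ)` restricted to that row is `det EQ · e_∅` (`Matrix.mul_adjugate`);
   dually the column `univ` of `P` is that of `1` (row action at `M = 1`; `univ` has `k + 3 ≥ 3`
   elements, so it is none of the sets of cardinality `≤ 2` involved), hence the column `univ` of
   `adj P` is `det P · e_univ` (`Matrix.adjugate_mul`);
3. `adj(F)_{∅,univ} = per_n` is Grenet's path count (`Grenet.adjugate_one_sub_empty_univ`,
   `Grenet.sum_ite_injective`, exactly as in `Grenet.isAffineDetRepr_repr`);
4. so `adj(K_full)_{∅,univ} = det EQ · per_n · det P = (−1)^(k+3) · per_n · (−1) = (−1)^k · per_n`.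

WHY. Stub V4 of the line: the composition `UniqStep_of` feeds this cofactor to the signed-minor stub
(V5), which turns the `ε`-signed `(univ, ∅)`-minor of `K_full` into an honest `(2ⁿ − 1) × (2ⁿ − 1)`
matrix of determinant `(−1)^k · per_n`; together with the rank profile of its `X(0,0)`-coefficient
(V6, V7) it is a second, inequivalent, optimal projection of the permanent — so the antecedent `Uniq n`
of the crux fails and `UniqStep` holds vacuously.

SOURCE. This session's construction (computations `compute/purify_*.py`); the matrix being purified is
that of B. Grenet, *An upper bound for the permanent versus determinant problem* (2011), Thm. 1, whose
path count `adj(1 − adj)_{∅,univ} = per_n` (Grenet's thesis 2012, Lemme 3.17) is vendored in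
`PermanentVsDeterminantProofs.lean`; the `(3,7)` twist is from J. Hüttenhain, C. Ikenmeyer, *Binary
determinantal complexity*, Linear Algebra Appl. 504 (2016). The lemmas here are elementary linear
algebra over a commutative ring.
-/

-- D-0017 layout: Sub = Summit for this single-conjunct summit, so the namespace repeats a component.
set_option linter.dupNamespace false

namespace Summit.ValiantsHypothesis.ValiantsHypothesis.Theorems.ProjectionStabilityUniqStep

open MvPolynomial
open scoped BigOperators Matrix
open Literature.Computability.AlgebraicComplexity

noncomputable section

/-! ### General helpers: one trivial row / column of `A` gives one scalar row / column of `adj A` -/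

/-- If the row `i` of `A` is the row `i` of the identity, then the row `i` of `adj A` is
`det A · e_i`, so `(adj A · B) i j = det A · B i j` (`A · adj A = det A · 1`). [folklore] -/
theorem adjugate_mul_apply_of_row_eq_one {n R : Type*} [Fintype n] [DecidableEq n] [CommRing R]
    (A B : Matrix n n R) (i j : n) (hrow : ∀ b, A i b = (1 : Matrix n n R) i b) :
    (A.adjugate * B) i j = A.det * B i j := by
  have h1 : ∀ a, A.adjugate i a = (A.det • (1 : Matrix n n R)) i a := by
    intro a
    rw [← Matrix.mul_adjugate A, Matrix.mul_apply]
    simp_rw [hrow]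
    rw [← Matrix.mul_apply, Matrix.one_mul]
  rw [Matrix.mul_apply]
  simp_rw [h1]
  rw [← Matrix.mul_apply, Matrix.smul_mul, Matrix.one_mul, Matrix.smul_apply, smul_eq_mul]

/-- If the column `j` of `A` is the column `j` of the identity, then the column `j` of `adj A` is
`det A · e_j`, so `(B · adj A) i j = det A · B i j` (`adj A · A = det A · 1`). [folklore] -/
theorem mul_adjugate_apply_of_col_eq_one {n R : Type*} [Fintype n] [DecidableEq n] [CommRing R]
    (A B : Matrix n n R) (i j : n) (hcol : ∀ b, A b j = (1 : Matrix n n R) b j) :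
    (B * A.adjugate) i j = A.det * B i j := by
  have h1 : ∀ c, A.adjugate c j = (A.det • (1 : Matrix n n R)) c j := by
    intro c
    rw [← Matrix.adjugate_mul A, Matrix.mul_apply]
    simp_rw [hcol]
    rw [← Matrix.mul_apply, Matrix.mul_one]
  rw [Matrix.mul_apply]
  simp_rw [h1]
  rw [← Matrix.mul_apply, Matrix.mul_smul, Matrix.mul_one, Matrix.smul_apply, smul_eq_mul]

/-- **Grenet's path count**, unreindexed: the `(∅, univ)` entry of `adj (1 − Grenet.adj k n)` is the
generic permanent `per_n` (the computation `hadj` of `Grenet.isAffineDetRepr_repr`).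
[cite: Grenet2011, Thm. 1] -/
theorem adjugate_one_sub_grenetAdj_empty_univ (R : Type*) [CommRing R] (n : ℕ) :
    (1 - Grenet.adj R n).adjugate ∅ Finset.univ = perPoly (Fin n) R := by
  rw [Grenet.adjugate_one_sub_empty_univ (Grenet.wt R n) (Grenet.adj_apply R n),
    Grenet.sum_ite_injective, perPoly, Matrix.permanent]
  refine Finset.sum_congr rfl fun σ _ => Finset.prod_congr rfl fun t _ => ?_
  rw [Matrix.mvPolynomialX_apply]
  simp [Grenet.wt]

/-- A subset of `Fin (k + 3)` with at most two elements is not `univ`. [folklore] -/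
theorem ne_univ_of_card_le_two {k : ℕ} {S : Finset (Fin (k + 3))} (hS : S.card ≤ 2) :
    S ≠ Finset.univ := by
  rintro rfl
  rw [Finset.card_univ, Fintype.card_fin] at hS
  omega

/-! ### The stub -/

/-- **STUB V4** of line `Sketch` (phase 2) of crux `UniqStep`: the `(∅, univ)` cofactor of the purified
source twist `P · (1 − Grenet.adj ℂ (k+3)) · EQ` is `(−1)^k · per_{k+3}`, for any `P`, `EQ` with the
registered row action / column action and determinants `−1`, `(−1)^(k+3)` (anti-multiplicativity of
the adjugate, `P` fixes the column `univ`, `EQ` fixes the row `∅`, and Grenet's path count).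
[folklore] -/
theorem stub_adjugate :
    ∀ (k : ℕ) (P EQ : Matrix (Finset (Fin (k + 3))) (Finset (Fin (k + 3))) (MvPolynomial (Fin (k + 3) × Fin (k + 3)) ℂ)),
    (∀ (M : Matrix (Finset (Fin (k + 3))) (Finset (Fin (k + 3))) (MvPolynomial (Fin (k + 3) × Fin (k + 3)) ℂ))
        (S T : Finset (Fin (k + 3))),
      (P * M) S T =
        if S = ∅ then -M ∅ T + M {0, 1} T
        else if S = {0} then M {0} T + M {1, 2} T
        else if S = {1} then -M ∅ T + M {1} T + M {0, 2} T
        else if S.card = 1 then M S T + M {0, 1} T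
        else M S T) →
    P.det = -1 →
    (∀ (M : Matrix (Finset (Fin (k + 3))) (Finset (Fin (k + 3))) (MvPolynomial (Fin (k + 3) × Fin (k + 3)) ℂ))
        (S T : Finset (Fin (k + 3))),
      (M * EQ) S T =
        if T = {1, 2} then M S {1, 2} - X (1, 0) * M S {0} + X (0, 0) * M S {1} - M S {0}
        else if T = {1} then -M S {1} + M S {0, 2}
        else if T.card = 1 then -M S T
        else M S T) →
    EQ.det = (-1) ^ (k + 3) →
    (P * (1 - Grenet.adj ℂ (k + 3)) * EQ).adjugate ∅ Finset.univ =
      (-1) ^ k * perPoly (Fin (k + 3)) ℂ := by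
  intro k P EQ hProw hPdet hEQcol hEQdet
  -- the index sets involved: `∅` is none of the nonempty sets, `univ` none of the small ones
  have n_e_0 : (∅ : Finset (Fin (k + 3))) ≠ {0} := (Finset.singleton_ne_empty 0).symm
  have n_e_1 : (∅ : Finset (Fin (k + 3))) ≠ {1} := (Finset.singleton_ne_empty 1).symm
  have n_e_02 : (∅ : Finset (Fin (k + 3))) ≠ {0, 2} := (Finset.insert_ne_empty 0 {2}).symm
  have n_e_12 : (∅ : Finset (Fin (k + 3))) ≠ {1, 2} := (Finset.insert_ne_empty 1 {2}).symm
  have n_e_u : (∅ : Finset (Fin (k + 3))) ≠ Finset.univ :=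
    ne_univ_of_card_le_two (by rw [Finset.card_empty]; omega)
  have n_0_u : ({0} : Finset (Fin (k + 3))) ≠ Finset.univ :=
    ne_univ_of_card_le_two (by rw [Finset.card_singleton]; omega)
  have n_1_u : ({1} : Finset (Fin (k + 3))) ≠ Finset.univ :=
    ne_univ_of_card_le_two (by rw [Finset.card_singleton]; omega)
  have n_01_u : ({0, 1} : Finset (Fin (k + 3))) ≠ Finset.univ :=
    ne_univ_of_card_le_two Finset.card_le_two
  have n_02_u : ({0, 2} : Finset (Fin (k + 3))) ≠ Finset.univ :=
    ne_univ_of_card_le_two Finset.card_le_two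
  have n_12_u : ({1, 2} : Finset (Fin (k + 3))) ≠ Finset.univ :=
    ne_univ_of_card_le_two Finset.card_le_two
  -- the row `∅` of `EQ` is the row `∅` of `1` (column action at `M = 1`)
  have hEQrow : ∀ b, EQ ∅ b = (1 : Matrix (Finset (Fin (k + 3))) (Finset (Fin (k + 3)))
      (MvPolynomial (Fin (k + 3) × Fin (k + 3)) ℂ)) ∅ b := by
    intro b
    have h := hEQcol 1 ∅ b
    rw [Matrix.one_mul] at h
    rw [h]
    split_ifs with hb1 hb2 hb3
    · subst hb1
      rw [Matrix.one_apply_ne n_e_12, Matrix.one_apply_ne n_e_0, Matrix.one_apply_ne n_e_1]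
      ring
    · subst hb2
      rw [Matrix.one_apply_ne n_e_1, Matrix.one_apply_ne n_e_02]
      ring
    · have hb : (∅ : Finset (Fin (k + 3))) ≠ b := by
        rintro rfl
        rw [Finset.card_empty] at hb3
        exact absurd hb3 (by decide)
      rw [Matrix.one_apply_ne hb, neg_zero]
    · rfl
  -- the column `univ` of `P` is the column `univ` of `1` (row action at `M = 1`)
  have hPcol : ∀ b, P b Finset.univ = (1 : Matrix (Finset (Fin (k + 3))) (Finset (Fin (k + 3)))
      (MvPolynomial (Fin (k + 3) × Fin (k + 3)) ℂ)) b Finset.univ := by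
    intro b
    have h := hProw 1 b Finset.univ
    rw [Matrix.mul_one] at h
    rw [h]
    split_ifs with hb1 hb2 hb3 hb4
    · subst hb1
      rw [Matrix.one_apply_ne n_e_u, Matrix.one_apply_ne n_01_u]
      ring
    · subst hb2
      rw [Matrix.one_apply_ne n_0_u, Matrix.one_apply_ne n_12_u]
      ring
    · subst hb3
      rw [Matrix.one_apply_ne n_e_u, Matrix.one_apply_ne n_02_u]
      ring
    · rw [Matrix.one_apply_ne n_01_u, add_zero]
    · rfl
  -- assemble: `adj (P F EQ) = adj EQ · (adj F · adj P)`
  rw [Matrix.adjugate_mul_distrib, Matrix.adjugate_mul_distrib,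
    adjugate_mul_apply_of_row_eq_one EQ _ ∅ Finset.univ hEQrow,
    mul_adjugate_apply_of_col_eq_one P _ ∅ Finset.univ hPcol,
    adjugate_one_sub_grenetAdj_empty_univ, hEQdet, hPdet]
  ring
end

end Summit.ValiantsHypothesis.ValiantsHypothesis.Theorems.ProjectionStabilityUniqStep
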